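import Summits.CriticalPhenomena.PercolationContinuityZ3.Theorems.PercNearOneGluingNoHeavyLowerTailCILReduction
import HarnessLib

/-!
# `NoHeavyLowerTail` (stmt-CriticalPhenomena-4575) — the FRONTIER-AVERAGED PORT inequality closes the crux

Support file (prover `prim-lf-2`, lemma factory "deletion–contraction / pivotal edge", gen 2; `--supports stmt-CriticalPhenomena-4575`).
No definitions, no named facts, no sorries.

Notation: `μ = prodBernoulli w` on `Fin n`, relays `A`, observer `o ∉ A`, level `j`, `N = |π(o)|` (relays joined to `o`),
`I(r) = μ{|π(r)| ≤ j}` (lightness of the relay `r` in the graph ITSELF).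

**The relay frontier.**  For a configuration `ω` and a relay `r`, say `r` is a FRONTIER relay of `o` when `o` is joined to `r` by an
open path all of whose interior vertices are non-relays; in symbols, `o` and `r` are connected in the open subgraph spanned by the
edges `e` with `∀ v ∈ e, v ∉ A ∨ v = r` (written inline below as `ω ∩ {e | ∀ v, v ∈ e → v ∉ A ∨ v = r}`).  `Γ*(ω) ⊆ A` is the set of
frontier relays; `{N ≥ 1} = {Γ* ≠ ∅}`, and on `{r ∈ Γ*}` one has `|π(o)| = |π(r)|`.

**The frontier-averaged port inequality (AP1-hull; census name `dir`, memo CANDIDATES.md §A8 of the seat).**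

  `μ{1 ≤ N ≤ j} ≤ E[ max_{r ∈ Γ*} I(r) ; Γ* ≠ ∅ ] = Σ_{∅ ≠ Y ⊆ A} μ{Γ* = Y} · max_{r ∈ Y} I(r)`.

It is stated below (hypothesis `hAP`) in the equivalent MAJORANT form: for every `φ : Finset (Fin n) → ℝ` with `I(r) ≤ φ Y`
whenever `r ∈ Y ⊆ A`, `μ{1 ≤ N ≤ j} ≤ Σ_{∅ ≠ Y ⊆ A} μ{Γ* = Y} · φ Y` (take `φ Y = max_{r∈Y} I(r)` to recover the displayed form;
conversely any majorant only enlarges the right side).  Single observer, own lightness, no witness rule, no gluing.  For an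
observer all of whose neighbours are relays (`Γ*` = the open coins of `o`) it is the averaged port lemma AP1 of the seat
`prim-lf-3` (paper proof; Lean `…CILAveragedPort*`).  Census (general hulls): exact-rational exhaustive `n = 6` 0 / 842 955,
`n = 5` 0 / 2 840, random `n ≤ 8` 0 / 32 340, ~420 adversarial climbs, inf of the normalised margin → 0+ (equalities only).

* `FrontierAveraging.frontierSet_disjoint` — the events `{Γ* = Y}`, `Y ⊆ A`, are pairwise disjoint, so their masses sum to at most `1`.
* `cumulativeIsolation_of_frontierAveraging` — **AP1-hull ⇒ `stub_cumulativeIsolation`** with the champion as witness: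
  `μ{1 ≤ N ≤ j} ≤ Σ_Y μ{Γ* = Y}·I(c) ≤ I(c)`.
* `noHeavyLowerTail_of_frontierAveraging` — **AP1-hull ⇒ NoHeavyLowerTail**, via the landed
  `noHeavyLowerTail_of_stub_cumulativeIsolation` (prim-gen-swap).
-/

noncomputable section

namespace Summit.CriticalPhenomena.PercolationContinuityZ3.Theorems

open MeasureTheory Set Literature.Probability.LatticeModels Literature.Probability.Percolation
open scoped Classical BigOperators

variable {n : ℕ}

namespace FrontierAveraging

/-- **The frontier-set events are pairwise disjoint.**  For `Y, Y' ⊆ A` distinct, no configuration has frontier equal to both.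
[folklore] -/
theorem frontierSet_disjoint (A : Finset (Fin n)) (o : Fin n) :
    PairwiseDisjoint (↑(A.powerset.erase ∅) : Set (Finset (Fin n)))
      (fun Y : Finset (Fin n) => {ω : BondConfig (Fin n) |
        ∀ r ∈ A, ((openGraph (ω ∩ {e | ∀ v, v ∈ e → v ∉ A ∨ v = r})).Reachable o r ↔ r ∈ Y)}) := by
  intro Y hY Y' hY' hne
  rw [Function.onFun, Set.disjoint_iff]
  intro ω hω
  simp only [Set.mem_inter_iff, Set.mem_setOf_eq] at hω
  apply hne
  have hYA : Y ⊆ A := Finset.mem_powerset.1 (Finset.mem_of_mem_erase (Finset.mem_coe.1 hY))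
  have hY'A : Y' ⊆ A := Finset.mem_powerset.1 (Finset.mem_of_mem_erase (Finset.mem_coe.1 hY'))
  ext r
  constructor
  · intro hr
    exact ((hω.2 r (hYA hr)).1 ((hω.1 r (hYA hr)).2 hr))
  · intro hr
    exact ((hω.1 r (hY'A hr)).1 ((hω.2 r (hY'A hr)).2 hr))

/-- **The frontier-set masses sum to at most one** (disjoint events in a probability space). [folklore] -/
theorem sum_frontierSet_le_one (w : Sym2 (Fin n) → unitInterval) (A : Finset (Fin n)) (o : Fin n) :
    ∑ Y ∈ A.powerset.erase ∅, (prodBernoulli w).real {ω : BondConfig (Fin n) |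
        ∀ r ∈ A, ((openGraph (ω ∩ {e | ∀ v, v ∈ e → v ∉ A ∨ v = r})).Reachable o r ↔ r ∈ Y)} ≤ 1 := by
  haveI : IsProbabilityMeasure (prodBernoulli w) := inferInstance
  rw [← measureReal_biUnion_finset (frontierSet_disjoint A o) (fun _ _ => MeasurableSet.of_discrete)]
  calc (prodBernoulli w).real (⋃ Y ∈ A.powerset.erase ∅, {ω : BondConfig (Fin n) |
          ∀ r ∈ A, ((openGraph (ω ∩ {e | ∀ v, v ∈ e → v ∉ A ∨ v = r})).Reachable o r ↔ r ∈ Y)})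
      ≤ (prodBernoulli w).real Set.univ := measureReal_mono (Set.subset_univ _) (measure_ne_top _ _)
    _ = 1 := probReal_univ

end FrontierAveraging

open FrontierAveraging in
/-- **The frontier-averaged port inequality implies the cumulative isolation lemma** (`stub_cumulativeIsolation` verbatim),
with the champion `c` (a relay of maximal lightness) as witness: apply the hypothesis with the constant majorant `φ ≡ I(c)`
and use `Σ_Y μ{Γ* = Y} ≤ 1`. -/
theorem cumulativeIsolation_of_frontierAveraging
    (hAP : ∀ (n : ℕ) (w : Sym2 (Fin n) → unitInterval) (A : Finset (Fin n)) (o : Fin n) (j : ℕ)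
      (φ : Finset (Fin n) → ℝ), o ∉ A →
      (∀ Y, Y ⊆ A → ∀ r ∈ Y,
        (Literature.Probability.LatticeModels.prodBernoulli w).real
            {ω : Literature.Probability.Percolation.BondConfig (Fin n) |
              (A.filter fun x => ω ∈ Literature.Probability.Percolation.openConn r x).card ≤ j} ≤ φ Y) →
      (Literature.Probability.LatticeModels.prodBernoulli w).real
          {ω : Literature.Probability.Percolation.BondConfig (Fin n) |
            1 ≤ (A.filter fun x => ω ∈ Literature.Probability.Percolation.openConn o x).card ∧
              (A.filter fun x => ω ∈ Literature.Probability.Percolation.openConn o x).card ≤ j} ≤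
        ∑ Y ∈ A.powerset.erase ∅,
          (Literature.Probability.LatticeModels.prodBernoulli w).real
              {ω : Literature.Probability.Percolation.BondConfig (Fin n) |
                ∀ r ∈ A, ((Literature.Probability.Percolation.openGraph
                  (ω ∩ {e | ∀ v, v ∈ e → v ∉ A ∨ v = r})).Reachable o r ↔ r ∈ Y)} * φ Y) :
    ∀ (n : ℕ) (w : Sym2 (Fin n) → unitInterval) (A : Finset (Fin n)) (o : Fin n) (j : ℕ),
      A.Nonempty → o ∉ A → ∃ a ∈ A,
        (Literature.Probability.LatticeModels.prodBernoulli w).real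
            {ω : Literature.Probability.Percolation.BondConfig (Fin n) |
              1 ≤ (A.filter fun x => ω ∈ Literature.Probability.Percolation.openConn o x).card ∧
                (A.filter fun x => ω ∈ Literature.Probability.Percolation.openConn o x).card ≤ j} ≤
          (Literature.Probability.LatticeModels.prodBernoulli w).real
            {ω : Literature.Probability.Percolation.BondConfig (Fin n) |
              (A.filter fun x => ω ∈ Literature.Probability.Percolation.openConn a x).card ≤ j} := by
  intro n w A o j hA ho
  haveI : IsProbabilityMeasure (prodBernoulli w) := inferInstance
  set I : Fin n → ℝ := fun a =>
    (prodBernoulli w).real {ω : BondConfig (Fin n) | (A.filter fun x => ω ∈ openConn a x).card ≤ j} with hI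
  obtain ⟨c, hc, hmax⟩ := A.exists_max_image I hA
  refine ⟨c, hc, ?_⟩
  have hmaj : ∀ Y, Y ⊆ A → ∀ r ∈ Y,
      (prodBernoulli w).real {ω : BondConfig (Fin n) | (A.filter fun x => ω ∈ openConn r x).card ≤ j} ≤ I c :=
    fun Y hY r hr => hmax r (hY hr)
  have key := hAP n w A o j (fun _ => I c) ho hmaj
  have hsum := sum_frontierSet_le_one w A o
  have hIc : 0 ≤ I c := measureReal_nonneg
  calc (prodBernoulli w).real {ω : BondConfig (Fin n) |
          1 ≤ (A.filter fun x => ω ∈ openConn o x).card ∧ (A.filter fun x => ω ∈ openConn o x).card ≤ j}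
      ≤ ∑ Y ∈ A.powerset.erase ∅, (prodBernoulli w).real {ω : BondConfig (Fin n) |
            ∀ r ∈ A, ((openGraph (ω ∩ {e | ∀ v, v ∈ e → v ∉ A ∨ v = r})).Reachable o r ↔ r ∈ Y)} * I c := key
    _ = (∑ Y ∈ A.powerset.erase ∅, (prodBernoulli w).real {ω : BondConfig (Fin n) |
            ∀ r ∈ A, ((openGraph (ω ∩ {e | ∀ v, v ∈ e → v ∉ A ∨ v = r})).Reachable o r ↔ r ∈ Y)}) * I c := by
          rw [Finset.sum_mul]
    _ ≤ 1 * I c := mul_le_mul_of_nonneg_right hsum hIc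
    _ = I c := one_mul _

open FrontierAveraging in
/-- **The frontier-averaged port inequality closes the crux**: AP1-hull ⇒ `stub_cumulativeIsolation` ⇒ `NoHeavyLowerTail`,
the last step being the landed `noHeavyLowerTail_of_stub_cumulativeIsolation`. -/
theorem noHeavyLowerTail_of_frontierAveraging
    (hAP : ∀ (n : ℕ) (w : Sym2 (Fin n) → unitInterval) (A : Finset (Fin n)) (o : Fin n) (j : ℕ)
      (φ : Finset (Fin n) → ℝ), o ∉ A →
      (∀ Y, Y ⊆ A → ∀ r ∈ Y,
        (Literature.Probability.LatticeModels.prodBernoulli w).real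
            {ω : Literature.Probability.Percolation.BondConfig (Fin n) |
              (A.filter fun x => ω ∈ Literature.Probability.Percolation.openConn r x).card ≤ j} ≤ φ Y) →
      (Literature.Probability.LatticeModels.prodBernoulli w).real
          {ω : Literature.Probability.Percolation.BondConfig (Fin n) |
            1 ≤ (A.filter fun x => ω ∈ Literature.Probability.Percolation.openConn o x).card ∧
              (A.filter fun x => ω ∈ Literature.Probability.Percolation.openConn o x).card ≤ j} ≤
        ∑ Y ∈ A.powerset.erase ∅,
          (Literature.Probability.LatticeModels.prodBernoulli w).real
              {ω : Literature.Probability.Percolation.BondConfig (Fin n) |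
                ∀ r ∈ A, ((Literature.Probability.Percolation.openGraph
                  (ω ∩ {e | ∀ v, v ∈ e → v ∉ A ∨ v = r})).Reachable o r ↔ r ∈ Y)} * φ Y) :
    Summit.CriticalPhenomena.PercolationContinuityZ3.Theses.PercNearOneGluing.NoHeavyLowerTail :=
  noHeavyLowerTail_of_stub_cumulativeIsolation (cumulativeIsolation_of_frontierAveraging hAP)

end Summit.CriticalPhenomena.PercolationContinuityZ3.Theorems

end
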